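import Summits.QuantumFields.YangMills.Theorems.UnitScaleTiltProp7InterpErrorPinAbstract
import Summits.QuantumFields.YangMills.Theorems.UnitScaleTiltProp7GreenKernelSiteFreeLaplace
import Summits.QuantumFields.YangMills.Theorems.UnitScaleTiltProp7PinnedKernelL1
import Summits.QuantumFields.YangMills.Theorems.UnitScaleTiltProp7TorusRadialSums
import Summits.QuantumFields.YangMills.Theorems.LangevinControlUVFemtoCurvatureTwoPointStubFieldStrengthCovariance
import HarnessLib

/-!
# Route `UnitScaleTilt`, crux K1 «MinimiserStabilityRegPr» (stmt-QuantumFields-19200), route-R E′ path (α′), (E1-b)-cov, row (hK₂-cov) — F3b-cov FILE 1: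
# THE TORUS-GREEN POTENTIAL OF A VECTOR-VALUED SOURCE ON A FINITE SET (`d = 3`) — its Laplacian, and the TWO-CENTRE SHELL SUM (C2)
# `Σ_{z ∈ B∖{y}} G̃(EK x − EK z)²·tdist(z,y)⁻² ≤ C_K ∕ tdist(x,y)`

Cell `ym3-torus`, width seat `ym3-torus-px7` (gen 3), on px11 g3's (hK₂-cov) LEAD WORDS 2 (L5) «TORUS-GREEN POTENTIAL ON A BALL» (2026-08-28T22:24:11Z; LOCATE #57 §1 (PIN)
row, lemma (C2)).  `--supports stmt-QuantumFields-19200`, count-neutral.  THEOREMS ONLY (0 `def`, 0 `sorry`).  YM₃ on T³ is a ladder rung (R3), not the Clay problem; nothing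
here claims the stub, the crux, d = 4 or the gap.

THE POINT.  In the covariant pin row (PIN-cov) the framed field `v` has `Δ₁v = (pin term) + f` with a junk source `f`; px11's F3c-cov subtracts the torus-Green potential
`w x := Σ_{z ∈ B} ½G̃(EK x − EK z)•f z` of the junk, whose flat Laplacian is `f·𝟙_B − |T|⁻¹Σ_B f` EXACTLY (§1), and needs POINTWISE and `ℓ²` bounds of `w` in terms of the
weighted mass `Σ tdist(z,y)²‖f z‖²` — whose kernel input is the two-centre sum (C2) (§2).  FILE 2 (`…TorusGreenPotentialBounds`) turns (C2) into the bounds (iii)–(v).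

WHAT IS PROVED (ns `…Theorems.Prop7TorusGreenPotentialBall`; `E` any real normed space; `G̃ = torusGreen` of period `L^k·sitesPerDir k` read through `EK`).
* §1 `laplace_add_apply`, `laplace_one_finset_sum_smul` (Laplacian of `x ↦ Σ_{z∈B} a z x • g z`), ★ `laplace_one_potential` — for ANY finset `B` and source `g : Site P 0 → E`:
  `laplace 1 w x = (if x ∈ B then g x else 0) − ((L^k·sitesPerDir k)^d)⁻¹ • Σ_{z∈B} g z` (✓ `laplace_one_torusGreen_EK_sub`, ✓ `torusGreen_neg`, ✓ `laplace_smul_const`).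
* §2 ★★ `sum_sq_torusGreen_div_sq_le` ((C2), `P.d = 3`): `∃ C_K ≥ 0, … (∀ z ∈ B, tdist z y ≤ R) → x ≠ y → tdist x y ≤ R →
  Σ_{z ∈ B.erase y} G̃(EK x − EK z)²·((tdist z y : ℝ)²)⁻¹ ≤ C_K ∕ tdist x y` — three regions: `2·tdist(z,x) ≤ s` (✓ `sum_ball_sq_torusGreen_EK_le` at centre `x`, `tdist(z,y) ≥ s∕2`),
  `tdist(z,y) ≤ 2s` (`G̃² ≤ 4C₁²∕s²`, ✓ `Prop7TorusRadialSums.sum_inv_tdist_sq_le`), `tdist(z,y) > 2s` (`G̃² ≤ 4C₁²∕tdist(z,y)²`, ✓ `sum_inv_tdist_pow_four_le`); `C_K = 8C_G + 2688C₁²`.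
HONEST SCOPE.  Flat lattice letters; the constants are the ∃-constants of ✓ `…InterpErrorHarmonicLetters` (`C_G`, `C₁`); nothing covariant here.

References: T. Bałaban, CMP 99 (1985) 75–102 [Balaban1985RegularSpaces] ((1.36) p.82); G. F. Lawler, V. Limic, *Random Walk: A Modern Introduction* (2010), Thm 4.3.1 [LawlerLimic2010].
-/

set_option autoImplicit false

noncomputable section

open scoped BigOperators

namespace Summit.QuantumFields.YangMills.Theorems.Prop7TorusGreenPotentialBall

open Literature.MathematicalPhysics.QuantumFieldTheory.Balaban1983to89
open Finset
open LatticeFieldCalculus (laplace)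
open B3Taylor310LocalRemainder (tdist_comm tdist_self tdist_triangle)
open B5Eq117TorusCarriers (EK)
open Literature.Probability.LatticeModels (torusGreen TorusSite)
open Summit.QuantumFields.YangMills.Theorems.Prop7GreenKernelSiteTransport (laplace_one_const_mul)
open Summit.QuantumFields.YangMills.Theorems.Prop7GreenKernelSiteFreeLaplace (laplace_one_torusGreen_EK_sub)
open Summit.QuantumFields.YangMills.Theorems.Prop7PinnedKernelL1 (laplace_smul_const)
open Summit.QuantumFields.YangMills.Theorems.FemtoCurvatureTwoPoint (torusGreen_neg)
open Summit.QuantumFields.YangMills.Theorems.Prop7TorusRadialSums (sum_inv_tdist_sq_le sum_inv_tdist_pow_four_le)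
open Summit.QuantumFields.YangMills.Theorems.Prop7InterpErrorHarmonicLetters (sum_ball_sq_torusGreen_EK_le abs_torusGreen_EK_sub_mul_tdist_le)
open Summit.QuantumFields.YangMills.Theorems.Prop7InterpErrorPinAbstract (tdist_pos_of_ne)

variable {P : Params} {j k : ℕ} {E : Type*} [NormedAddCommGroup E] [NormedSpace ℝ E]

/-! ## §1 The Laplacian of the potential -/

/-- additivity of the lattice Laplacian at a site, for vector-valued fields. [folklore] -/
theorem laplace_add_apply (c : ℝ) (u v : SiteField P j E) (x : Site P j) :
    laplace c (fun w => u w + v w) x = laplace c u x + laplace c v x := by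
  simp only [laplace]
  rw [← Finset.sum_add_distrib]
  refine Finset.sum_congr rfl fun μ _ => ?_
  module

/-- the flat Laplacian of `x ↦ Σ_{z∈B} a z x • g z` is `Σ_{z∈B} (laplace 1 (a z) x) • g z`. [folklore] -/
theorem laplace_one_finset_sum_smul (B : Finset (Site P j)) (a : Site P j → SiteField P j ℝ) (g : Site P j → E) (x : Site P j) :
    laplace 1 (fun x => ∑ z ∈ B, a z x • g z) x = ∑ z ∈ B, laplace 1 (a z) x • g z := by
  classical
  induction B using Finset.induction_on with
  | empty =>
      simp only [Finset.sum_empty, laplace, smul_zero, add_zero, sub_self, Finset.sum_const_zero]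
  | insert b B hb ih =>
      simp only [Finset.sum_insert hb]
      have hadd : laplace 1 (fun x => a b x • g b + ∑ z ∈ B, a z x • g z) x
          = laplace 1 (fun x => a b x • g b) x + laplace 1 (fun x => ∑ z ∈ B, a z x • g z) x :=
        laplace_add_apply 1 (fun x => a b x • g b) (fun x => ∑ z ∈ B, a z x • g z) x
      rw [hadd, ih, congrFun (laplace_smul_const 1 (a b) (g b)) x]

/-- ★ **THE LAPLACIAN OF THE TORUS-GREEN POTENTIAL**: for any finset `B`, any source `g : Site P 0 → E` and `w x = Σ_{z∈B} ½G̃(EK x − EK z)•g z`,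
`laplace 1 w x = (if x ∈ B then g x else 0) − ((L^k·sitesPerDir k)^d)⁻¹ • Σ_{z∈B} g z` (the Poisson equation ✓ `laplace_one_torusGreen_EK_sub` `laplace 1 G̃(EK z − EK ·) = 2(𝟙_z − |T|⁻¹)`,
evenness ✓ `torusGreen_neg`, linearity). [cite: Balaban1985RegularSpaces, (1.36) p.82] -/
theorem laplace_one_potential (hk : k ≤ P.m + P.K) (B : Finset (Site P 0)) (g : Site P 0 → E) (w : Site P 0 → E)
    (hw : ∀ x, w x = ∑ z ∈ B, ((2 : ℝ)⁻¹ * torusGreen (L := P.L ^ k * P.sitesPerDir k) (EK hk x - EK hk z)) • g z) (x : Site P 0) :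
    laplace 1 w x = (if x ∈ B then g x else 0) - ((((P.L ^ k * P.sitesPerDir k : ℕ) : ℝ) ^ P.d)⁻¹) • ∑ z ∈ B, g z := by
  classical
  haveI : NeZero (P.L ^ k * P.sitesPerDir k) := ⟨mul_ne_zero (pow_ne_zero _ P.L_pos.ne') (P.sitesPerDir_ne_zero k)⟩
  set T : ℝ := (((P.L ^ k * P.sitesPerDir k : ℕ) : ℝ)) ^ P.d with hT
  have hwf : w = fun x => ∑ z ∈ B, (fun z x => (2 : ℝ)⁻¹ * torusGreen (L := P.L ^ k * P.sitesPerDir k) (EK hk x - EK hk z)) z x • g z :=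
    funext hw
  rw [hwf, laplace_one_finset_sum_smul]
  -- the coefficient at `z`: `laplace 1 (½G̃(EK · − EK z)) x = 𝟙[x = z] − T⁻¹`
  have hcoef : ∀ z, laplace 1 (fun x => (2 : ℝ)⁻¹ * torusGreen (L := P.L ^ k * P.sitesPerDir k) (EK hk x - EK hk z)) x
      = (if x = z then (1 : ℝ) else 0) - T⁻¹ := by
    intro z
    have hev : (fun x => (2 : ℝ)⁻¹ * torusGreen (L := P.L ^ k * P.sitesPerDir k) (EK hk x - EK hk z))
        = fun x => (2 : ℝ)⁻¹ * torusGreen (L := P.L ^ k * P.sitesPerDir k) (EK hk z - EK hk x) := by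
      funext x'; rw [← torusGreen_neg, neg_sub]
    rw [hev, laplace_one_const_mul, laplace_one_torusGreen_EK_sub hk z x, hT]
    ring
  simp_rw [hcoef, sub_smul, Finset.sum_sub_distrib, ite_smul, one_smul, zero_smul, Finset.sum_ite_eq, ← Finset.smul_sum]

/-! ## §2 ★★ (C2) The two-centre shell sum -/

/-- ★★ **(C2) THE TWO-CENTRE SHELL SUM** (`P.d = 3`): there is an absolute `C_K ≥ 0` such that for every finset `B` inside the ball `{tdist(·,y) ≤ R}`, every `x ≠ y` with
`tdist(x,y) ≤ R`:  `Σ_{z ∈ B∖{y}} G̃(EK x − EK z)²·tdist(z,y)⁻² ≤ C_K ∕ tdist(x,y)` — the lattice form of `∫_{B} |x − z|⁻²|z − y|⁻² dz ≲ |x − y|⁻¹` in `ℝ³`.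
Regions (`s := tdist(x,y)`): `2·tdist(z,x) ≤ s` (then `tdist(z,y) ≥ s∕2`; ✓ `sum_ball_sq_torusGreen_EK_le`), `tdist(z,y) ≤ 2s` (then `tdist(x,z) > s∕2`, `G̃² ≤ 4C₁²∕s²`;
✓ `sum_inv_tdist_sq_le`), `tdist(z,y) > 2s` (then `tdist(x,z) ≥ tdist(z,y)∕2`; ✓ `sum_inv_tdist_pow_four_le`). [cite: LawlerLimic2010, Thm 4.3.1] -/
theorem sum_sq_torusGreen_div_sq_le : ∃ CK : ℝ, 0 ≤ CK ∧ ∀ (P : Params) (_ : P.d = 3) (k : ℕ) (hk : k ≤ P.m + P.K)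
    (y x : Site P 0) (B : Finset (Site P 0)) (R : ℕ), (∀ z ∈ B, Site.tdist z y ≤ R) → x ≠ y → Site.tdist x y ≤ R →
      ∑ z ∈ B.erase y, (torusGreen (L := P.L ^ k * P.sitesPerDir k) (EK hk x - EK hk z)) ^ 2 * ((((Site.tdist z y : ℕ) : ℝ)) ^ 2)⁻¹
        ≤ CK / (Site.tdist x y : ℝ) := by
  obtain ⟨CG, hCG, hGsum⟩ := sum_ball_sq_torusGreen_EK_le
  obtain ⟨C₁, hC₁, hG1⟩ := abs_torusGreen_EK_sub_mul_tdist_le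
  refine ⟨8 * CG + 2688 * C₁ ^ 2, by positivity, ?_⟩
  intro P hd k hk y x B R hB hxy hxR
  classical
  set s : ℕ := Site.tdist x y with hs
  have hs1 : 1 ≤ s := tdist_pos_of_ne hxy
  have hsR : (s : ℝ) ≤ R := by exact_mod_cast hxR
  have hs0 : (0 : ℝ) < s := by exact_mod_cast hs1
  set G : Site P 0 → ℝ := fun z => torusGreen (L := P.L ^ k * P.sitesPerDir k) (EK hk x - EK hk z) with hGdef
  set F : Site P 0 → ℝ := fun z => G z ^ 2 * ((((Site.tdist z y : ℕ) : ℝ)) ^ 2)⁻¹ with hF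
  have hF0 : ∀ z, 0 ≤ F z := fun z => by rw [hF]; positivity
  -- pointwise Green rows
  have hGpt : ∀ z, z ≠ x → |G z| * (Site.tdist x z : ℝ) ≤ C₁ := fun z hz => by rw [hGdef]; exact hG1 P hd k hk x z hz
  have hGsq : ∀ z, z ≠ x → ∀ {t : ℝ}, 0 < t → t ≤ Site.tdist x z → G z ^ 2 ≤ C₁ ^ 2 / t ^ 2 := by
    intro z hz t ht htz
    have h1 : |G z| * t ≤ C₁ := le_trans (mul_le_mul_of_nonneg_left htz (abs_nonneg _)) (hGpt z hz)
    rw [le_div_iff₀ (by positivity), ← sq_abs, ← mul_pow]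
    exact pow_le_pow_left₀ (by positivity) h1 2
  -- the three regions
  set S := B.erase y with hS
  set S₁ := S.filter (fun z => 2 * Site.tdist z x ≤ s) with hS₁
  set S' := S.filter (fun z => ¬ 2 * Site.tdist z x ≤ s) with hS'
  set S₂ := S'.filter (fun z => Site.tdist z y ≤ 2 * s) with hS₂
  set S₃ := S'.filter (fun z => ¬ Site.tdist z y ≤ 2 * s) with hS₃
  have hsplit : ∑ z ∈ S, F z = ∑ z ∈ S₁, F z + (∑ z ∈ S₂, F z + ∑ z ∈ S₃, F z) := by
    rw [hS₂, hS₃, Finset.sum_filter_add_sum_filter_not, hS₁, hS', Finset.sum_filter_add_sum_filter_not]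
  have hmemS : ∀ z ∈ S, z ≠ y ∧ z ∈ B := fun z hz => Finset.mem_erase.1 hz
  -- region 1: near `x`
  have h1 : ∑ z ∈ S₁, F z ≤ 8 * CG / s := by
    have hpt : ∀ z ∈ S₁, F z ≤ 4 / (s : ℝ) ^ 2 * G z ^ 2 := by
      intro z hz
      rw [hS₁, Finset.mem_filter] at hz
      obtain ⟨hzS, hzx⟩ := hz
      have hzy : z ≠ y := (hmemS z hzS).1
      -- `tdist(z,y) ≥ s/2`
      have htri : s ≤ Site.tdist x z + Site.tdist z y := tdist_triangle x z y
      rw [tdist_comm x z] at htri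
      have hlow : (s : ℝ) ≤ 2 * (Site.tdist z y : ℝ) := by
        have : s ≤ 2 * Site.tdist z y := by omega
        exact_mod_cast this
      have hzy0 : (0 : ℝ) < Site.tdist z y := by exact_mod_cast tdist_pos_of_ne hzy
      rw [hF]; dsimp only
      rw [mul_comm]
      refine mul_le_mul_of_nonneg_right ?_ (sq_nonneg _)
      rw [inv_le_comm₀ (by positivity) (by positivity), inv_div]
      have : (s : ℝ) ^ 2 ≤ 4 * (Site.tdist z y : ℝ) ^ 2 := by nlinarith
      linarith [this]
    have hsub : S₁ ⊆ Finset.univ.filter (fun z : Site P 0 => (Site.tdist z x : ℝ) ≤ ((s : ℕ) : ℝ)) := by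
      intro z hz
      rw [hS₁, Finset.mem_filter] at hz
      rw [Finset.mem_filter]
      exact ⟨Finset.mem_univ _, by exact_mod_cast (by omega : Site.tdist z x ≤ s)⟩
    have hball := hGsum P hd k hk x s
    calc ∑ z ∈ S₁, F z ≤ ∑ z ∈ S₁, 4 / (s : ℝ) ^ 2 * G z ^ 2 := Finset.sum_le_sum hpt
      _ = 4 / (s : ℝ) ^ 2 * ∑ z ∈ S₁, G z ^ 2 := by rw [Finset.mul_sum]
      _ ≤ 4 / (s : ℝ) ^ 2 * ∑ z ∈ Finset.univ.filter (fun z : Site P 0 => (Site.tdist z x : ℝ) ≤ ((s : ℕ) : ℝ)), G z ^ 2 :=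
          mul_le_mul_of_nonneg_left (Finset.sum_le_sum_of_subset_of_nonneg hsub fun _ _ _ => sq_nonneg _) (by positivity)
      _ ≤ 4 / (s : ℝ) ^ 2 * (CG * ((s : ℝ) + 1)) := mul_le_mul_of_nonneg_left (by rw [hGdef]; exact hball) (by positivity)
      _ ≤ 4 / (s : ℝ) ^ 2 * (CG * (2 * s)) := by
          have hs1R : (1 : ℝ) ≤ s := by exact_mod_cast hs1
          exact mul_le_mul_of_nonneg_left (mul_le_mul_of_nonneg_left (by linarith) hCG) (by positivity)
      _ = 8 * CG / s := by field_simp; ring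
  -- regions 2 and 3 share `tdist(x,z) > s/2`
  have hfar : ∀ z ∈ S', z ≠ x ∧ (s : ℝ) < 2 * (Site.tdist x z : ℝ) ∧ z ≠ y ∧ z ∈ B := by
    intro z hz
    rw [hS', Finset.mem_filter] at hz
    obtain ⟨hzS, hzx⟩ := hz
    refine ⟨fun h => hzx ?_, ?_, (hmemS z hzS).1, (hmemS z hzS).2⟩
    · rw [h, tdist_self]; omega
    · rw [tdist_comm x z]; exact_mod_cast (by omega : s < 2 * Site.tdist z x)
  -- region 2
  have h2 : ∑ z ∈ S₂, F z ≤ 1536 * C₁ ^ 2 / s := by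
    have hpt : ∀ z ∈ S₂, F z ≤ 4 * C₁ ^ 2 / (s : ℝ) ^ 2 * ((((Site.tdist z y : ℕ) : ℝ)) ^ 2)⁻¹ := by
      intro z hz
      rw [hS₂, Finset.mem_filter] at hz
      obtain ⟨hzx, hlt, -, -⟩ := hfar z hz.1
      have hG2 : G z ^ 2 ≤ C₁ ^ 2 / ((s : ℝ) / 2) ^ 2 := hGsq z hzx (by positivity) (by linarith)
      rw [hF]; dsimp only
      refine mul_le_mul_of_nonneg_right (hG2.trans (le_of_eq ?_)) (by positivity)
      field_simp; ring
    have hS₂b : ∀ z ∈ S₂, 1 ≤ Site.tdist z y ∧ Site.tdist z y ≤ 2 * s := by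
      intro z hz
      rw [hS₂, Finset.mem_filter] at hz
      exact ⟨tdist_pos_of_ne (hfar z hz.1).2.2.1, hz.2⟩
    have hrad := sum_inv_tdist_sq_le hd S₂ y (M := 1) (N := 2 * s) le_rfl (by omega) hS₂b
    calc ∑ z ∈ S₂, F z ≤ ∑ z ∈ S₂, 4 * C₁ ^ 2 / (s : ℝ) ^ 2 * ((((Site.tdist z y : ℕ) : ℝ)) ^ 2)⁻¹ := Finset.sum_le_sum hpt
      _ = 4 * C₁ ^ 2 / (s : ℝ) ^ 2 * ∑ z ∈ S₂, ((((Site.tdist z y : ℕ) : ℝ)) ^ 2)⁻¹ := by rw [Finset.mul_sum]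
      _ ≤ 4 * C₁ ^ 2 / (s : ℝ) ^ 2 * (192 * ((2 * s : ℕ) : ℝ)) := mul_le_mul_of_nonneg_left hrad (by positivity)
      _ = 1536 * C₁ ^ 2 / s := by push_cast; field_simp; ring
  -- region 3
  have h3 : ∑ z ∈ S₃, F z ≤ 1152 * C₁ ^ 2 / s := by
    have hpt : ∀ z ∈ S₃, F z ≤ 4 * C₁ ^ 2 * ((((Site.tdist z y : ℕ) : ℝ)) ^ 4)⁻¹ := by
      intro z hz
      rw [hS₃, Finset.mem_filter] at hz
      obtain ⟨hzx, -, hzy, -⟩ := hfar z hz.1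
      have hbig : 2 * s < Site.tdist z y := by have := hz.2; omega
      -- `tdist(x,z) ≥ tdist(z,y)/2`
      have htri : Site.tdist z y ≤ Site.tdist z x + Site.tdist x y := tdist_triangle z x y
      have hlow : (Site.tdist z y : ℝ) ≤ 2 * (Site.tdist x z : ℝ) := by
        rw [tdist_comm x z]; exact_mod_cast (by omega : Site.tdist z y ≤ 2 * Site.tdist z x)
      have hzy0 : (0 : ℝ) < Site.tdist z y := by exact_mod_cast tdist_pos_of_ne hzy
      have hG2 : G z ^ 2 ≤ C₁ ^ 2 / ((Site.tdist z y : ℝ) / 2) ^ 2 := hGsq z hzx (by positivity) (by linarith)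
      rw [hF]; dsimp only
      calc G z ^ 2 * ((((Site.tdist z y : ℕ) : ℝ)) ^ 2)⁻¹ ≤ C₁ ^ 2 / ((Site.tdist z y : ℝ) / 2) ^ 2 * ((((Site.tdist z y : ℕ) : ℝ)) ^ 2)⁻¹ :=
            mul_le_mul_of_nonneg_right hG2 (by positivity)
        _ = 4 * C₁ ^ 2 * ((((Site.tdist z y : ℕ) : ℝ)) ^ 4)⁻¹ := by field_simp; ring
    by_cases hR : 2 * s + 1 ≤ R
    · have hS₃b : ∀ z ∈ S₃, 2 * s + 1 ≤ Site.tdist z y ∧ Site.tdist z y ≤ R := by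
        intro z hz
        rw [hS₃, Finset.mem_filter] at hz
        exact ⟨by have := hz.2; omega, hB z (hfar z hz.1).2.2.2⟩
      have hrad := sum_inv_tdist_pow_four_le hd S₃ y (M := 2 * s + 1) (N := R) (by omega) hR hS₃b
      calc ∑ z ∈ S₃, F z ≤ ∑ z ∈ S₃, 4 * C₁ ^ 2 * ((((Site.tdist z y : ℕ) : ℝ)) ^ 4)⁻¹ := Finset.sum_le_sum hpt
        _ = 4 * C₁ ^ 2 * ∑ z ∈ S₃, ((((Site.tdist z y : ℕ) : ℝ)) ^ 4)⁻¹ := by rw [Finset.mul_sum]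
        _ ≤ 4 * C₁ ^ 2 * (576 / ((2 * s + 1 : ℕ) : ℝ)) := mul_le_mul_of_nonneg_left hrad (by positivity)
        _ ≤ 1152 * C₁ ^ 2 / s := by
            rw [mul_div_assoc', div_le_div_iff₀ (by positivity) hs0]
            push_cast; nlinarith [sq_nonneg C₁, mul_nonneg (sq_nonneg C₁) hs0.le]
    · -- the region is empty
      have hemp : ∀ z ∈ S₃, F z = 0 := by
        intro z hz
        exfalso
        rw [hS₃, Finset.mem_filter] at hz
        have := hB z (hfar z hz.1).2.2.2
        omega
      rw [Finset.sum_eq_zero hemp]; positivity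
  -- total
  have htot : ∑ z ∈ S, F z ≤ (8 * CG + 2688 * C₁ ^ 2) / s := by
    rw [hsplit]
    have e : (8 * CG + 2688 * C₁ ^ 2) / (s : ℝ) = 8 * CG / s + (1536 * C₁ ^ 2 / s + 1152 * C₁ ^ 2 / s) := by
      field_simp; ring
    rw [e]
    exact add_le_add h1 (add_le_add h2 h3)
  simpa only [hF, hGdef, hs] using htot

end Summit.QuantumFields.YangMills.Theorems.Prop7TorusGreenPotentialBall

end
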